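import Literature.MathematicalPhysics.QuantumLattice.HubbardTorusBlochCurrentBound
import Literature.MathematicalPhysics.QuantumLattice.HubbardRingPerronFrobeniusProofs
import HarnessLib

/-!
# The flux envelope of the Hubbard torus is uniformly Lipschitz (Bloch's theorem at every flux)

Topic `Literature/MathematicalPhysics/QuantumLattice` (family `hubbard`); companion of
`HubbardTorusFlux.lean`, `HubbardTorusFluxBlochBound.lean`, `HubbardTorusBlochCurrentBound.lean`,
`HubbardTorusFluxStiffnessResponse.lean`. Everything here is PROVED; no definitions, no named facts.

`E_L(θ) = fluxEnergy L U δ θ` is the lowest energy of the Hubbard torus `(ℤ/Lℤ)²` (`t = 1`,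
coupling `U`) with flux `θ` through the `e₁`-cycle, in the sector of `N_L = 2⌊(1-δ)L²/2⌋` electrons
and `S^z = 0` (Byers–Yang / Kohn / Scalapino–White–Zhang envelope). The tree has: `2π`-periodicity and
evenness in `θ`, the Bloch ceiling `E_L(θ) ≤ E_L(0) + 2θ²` (base flux `0`), and Bloch's bound on the
persistent current of zero-flux sector ground states. This file proves the same AT EVERY BASE FLUX
and packages it as a modulus of continuity of the envelope that is uniform in `L ≥ 4`, `U`, `δ ≥ 0`:

* `exists_unit_rayleigh_eq_fluxEnergy` — the flux envelope is attained: a unit vector of the sector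
  whose energy in the uniformly twisted torus `H_Φ` (twist `e^{iΦ/L}` on every `e₁`-bond) is `E_L(Φ)`;
* `minEnergyOn_uniformTwistConfig_le_rayleigh_twist`, `fluxEnergy_le_rayleigh_add_pricing` —
  two-twist pricing: for every unit sector vector `φ`,
  `E_L(Φ + sL) ≤ Re⟨φ, H_Φ φ⟩ + P(φ)(1 - cos s) + Q(φ) sin s` with
  `P = 2(K cos(Φ/L) - J̃ sin(Φ/L))`, `Q = 2(K sin(Φ/L) + J̃ cos(Φ/L))`, `K = Σ Re h`, `J̃ = Σ Im h`,
  `h_{x,σ} = ⟨φ, c†_{x+e₁,σ} c_{x,σ} φ⟩` (`Q` is the gauge-covariant `e₁`-current of `φ` at flux `Φ`);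
* `abs_current_le_of_rayleigh_eq_fluxEnergy` — **Bloch's theorem at flux `Φ`**: a unit sector vector
  attaining `E_L(Φ)` in `H_Φ` has `|Q| ≤ (π²/(2L)) |P| ≤ 4π² L` (integer twists `±2π` are pure gauges
  at any base flux; Jordan's inequality);
* `pricing_excess_le`, `fluxEnergy_add_le` — **the modulus of continuity**:
  `E_L(Φ + η) ≤ E_L(Φ) + 4π²|η| + 4η²` for all real `Φ, η`, all `L ≥ 4`, `U`, `0 ≤ δ`;
* `abs_fluxEnergy_sub_fluxEnergy_le`, `abs_fluxEnergy_sub_fluxEnergy_le_mul` —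
  `|E_L(Φ) - E_L(Φ')| ≤ 4π²|Φ - Φ'| + 4(Φ - Φ')²`, hence `continuous_fluxEnergy` and
  `fluxEnergy_uniformEquicontinuous`: the family `{E_L}_{L ≥ 4}` is uniformly equicontinuous (the
  input of every compactness argument on flux envelopes, e.g. subsequential limits of
  `E_L(θ) - E_L(0)`, the object of the flux criteria of routes `FluxSpectroscopy`,
  `ParityGapRigidity` (crux `IncommensurateRigidity`) and `EatTheGoldstone`).

Physically: `dE_L/dΦ` is the persistent current through the seam, which Bloch's theorem bounds by
`O(1)` uniformly in `L` at every flux (Bohm 1949; Watanabe 2019; Tada–Koma 2016).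

## References

* D. Bohm, Phys. Rev. 75 (1949) 502 (Bloch's theorem on persistent currents). [Bohm1949]
* H. Watanabe, J. Stat. Phys. 177 (2019) 717, §2.2.1 eqs. (13)–(16), §2.2.3, §4.1. [Watanabe2019]
* Y. Tada, T. Koma, J. Stat. Phys. 165 (2016) 455, §2. [TadaKoma2016]
* N. Byers, C. N. Yang, PRL 7 (1961) 46. [ByersYang1961]
* D. J. Scalapino, S. R. White, S. C. Zhang, PRB 47 (1993) 7995. [ScalapinoWhiteZhang1993]
-/

noncomputable section

namespace Literature.MathematicalPhysics.QuantumLattice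

open Matrix Finset Real Literature.MathematicalPhysics.QuantumFieldTheory

variable {L : ℕ} [NeZero L]

/-! ### Hopping sums of a unit vector -/

/-- The `e₁`-current sum of a unit vector is at most the number of its terms:
`|Σ_{x,σ} Im h_{x,0,σ}(φ)| ≤ 2L²` (each `|h| ≤ 1`). Companion of `abs_sum_re_hop_le`. [folklore] -/
theorem abs_sum_im_hop_le {φ : Fock (Orb (FermionTorus 2 L))} (hφ : star φ ⬝ᵥ φ = 1) :
    |∑ x : Site 2 L, ∑ σ : Fin 2,
        (star φ ⬝ᵥ ((creation (orb (FermionTorus.ofTorusSite (Site.shift x 0)) σ) *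
          annihilation (orb (FermionTorus.ofTorusSite x) σ)) *ᵥ φ)).im| ≤ 2 * (L : ℝ) ^ 2 := by
  refine (Finset.abs_sum_le_sum_abs _ _).trans ?_
  have h : ∀ x ∈ (Finset.univ : Finset (Site 2 L)), |∑ σ : Fin 2,
      (star φ ⬝ᵥ ((creation (orb (FermionTorus.ofTorusSite (Site.shift x 0)) σ) *
        annihilation (orb (FermionTorus.ofTorusSite x) σ)) *ᵥ φ)).im| ≤ 2 := fun x _ => by
    refine (Finset.abs_sum_le_sum_abs _ _).trans ?_
    refine (Finset.sum_le_sum fun σ _ => (Complex.abs_im_le_norm _).trans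
      (norm_star_dotProduct_creation_mul_annihilation_mulVec_le hφ _ _)).trans ?_
    simp
  refine (Finset.sum_le_sum h).trans ?_
  rw [Finset.sum_const, Finset.card_univ, nsmul_eq_mul]
  have hcard : (Fintype.card (Site 2 L) : ℝ) = (L : ℝ) ^ 2 := by
    rw [Fintype.card_fun, ZMod.card, Fintype.card_fin]; push_cast; ring
  rw [hcard]
  ring_nf
  rfl

/-! ### The flux envelope is attained in the uniformly twisted torus -/

/-- **The flux envelope is attained** (`L ≥ 3`, `0 ≤ δ`): some unit vector `φ` of the sector
`(N_L, S^z = 0)`, `N_L = 2⌊(1-δ)L²/2⌋`, has energy exactly `E_L(Φ) = fluxEnergy L U δ Φ` in the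
uniformly twisted torus `H_Φ = magneticHubbardTorus L (uniformTwistConfig L Φ) 1 U` (the sector is
non-empty since `⌊(1-δ)L²/2⌋ ≤ L² = |Λ|`; `H_Φ` is Hermitian and block diagonal in `(N↑, N↓)`, so
`sector_groundState` applies; seam flux and uniform twist have the same sector energies).
Tasaki (2020) §2.2; Watanabe (2019) §2.2.3. [folklore] -/
theorem exists_unit_rayleigh_eq_fluxEnergy (hL : 3 ≤ L) (U : ℝ) {δ : ℝ} (hδ : 0 ≤ δ) (Φ : ℝ) :
    ∃ φ : Fock (Orb (FermionTorus 2 L)),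
      φ ∈ szSector (2 * ⌊(1 - δ) * (L : ℝ) ^ 2 / 2⌋₊) 0 ∧ star φ ⬝ᵥ φ = 1 ∧
        (star φ ⬝ᵥ (magneticHubbardTorus L (uniformTwistConfig L Φ) 1 U *ᵥ φ)).re =
          fluxEnergy L U δ Φ := by
  classical
  set n := ⌊(1 - δ) * (L : ℝ) ^ 2 / 2⌋₊ with hn
  set H := magneticHubbardTorus L (uniformTwistConfig L Φ) 1 U with hH
  -- the sector `(n, n)` is non-empty: `n ≤ L² = |Λ|`
  have hcard : Fintype.card (FermionTorus 2 L) = L ^ 2 := by simp [FermionTorus, Fintype.card_lex]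
  have hnle : n ≤ Fintype.card (FermionTorus 2 L) := by
    rw [hcard]
    have h1 : (1 - δ) * (L : ℝ) ^ 2 / 2 ≤ (L : ℝ) ^ 2 := by nlinarith [sq_nonneg (L : ℝ)]
    have h2 : (n : ℝ) ≤ (L : ℝ) ^ 2 := by
      by_cases h0 : 0 ≤ (1 - δ) * (L : ℝ) ^ 2 / 2
      · exact (Nat.floor_le h0).trans h1
      · rw [hn, Nat.floor_of_nonpos (le_of_lt (not_le.1 h0)), Nat.cast_zero]; positivity
    exact_mod_cast h2
  obtain ⟨α₀, -, hα₀⟩ : ∃ α₀ : Finset (FermionTorus 2 L), α₀ ⊆ univ ∧ α₀.card = n :=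
    Finset.exists_subset_card_eq (by rwa [Finset.card_univ])
  have hp : ∃ s : Finset (Orb (FermionTorus 2 L)), (upPart s).card = n ∧ (downPart s).card = n :=
    ⟨pairSet α₀ α₀, by rw [upPart_pairSet, hα₀], by rw [downPart_pairSet, hα₀]⟩
  have hinv : ∀ s s' : Finset (Orb (FermionTorus 2 L)),
      ¬((upPart s).card = n ∧ (downPart s).card = n) →
        ((upPart s').card = n ∧ (downPart s').card = n) → H s s' = 0 := by
    intro s s' hs hs'
    by_contra h
    have := preservesSectors_magneticHubbardTorus (uniformTwistConfig L Φ) 1 U s s' h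
    exact hs ⟨this.1.trans hs'.1, this.2.trans hs'.2⟩
  have hK : ∀ v : Fock (Orb (FermionTorus 2 L)), v ∈ szSector (2 * n) (0 : ℝ) ↔
      ∀ s, ¬((upPart s).card = n ∧ (downPart s).card = n) → v s = 0 :=
    fun v => mem_szSector_two_mul_zero_iff n v
  obtain ⟨⟨v, hv, hv0, hHv⟩, -⟩ := sector_groundState H (magneticHubbardTorus_isHermitian _ 1 U)
    (fun s => (upPart s).card = n ∧ (downPart s).card = n) hp hinv (szSector (2 * n) 0) hK
  obtain ⟨c, hc0, hc1⟩ := exists_smul_unit hv0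
  refine ⟨c • v, Submodule.smul_mem _ c hv, hc1, ?_⟩
  have heig : H *ᵥ (c • v) = ((H.minEnergyOn (szSector (2 * n) 0) : ℝ) : ℂ) • (c • v) := by
    rw [mulVec_smul, hHv, smul_comm]
  rw [heig, dotProduct_smul, hc1, smul_eq_mul, mul_one, Complex.ofReal_re, hH,
    ← fluxEnergy_eq_minEnergyOn_uniformTwistConfig hL]

/-! ### Two-twist pricing -/

/-- **Two-twist pricing.** For every unit vector `φ` of a joint sector `(N, S^z = M)` and all twists
`Φ, Ψ`: `E₀(H_Ψ; N,M) ≤ Re⟨φ, H_Φ φ⟩ + 2(cos(Φ/L) - cos(Ψ/L)) K(φ) + 2(sin(Ψ/L) - sin(Φ/L)) J̃(φ)`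
(price `φ` in `H_Ψ` and expand both `Re⟨φ, H_Ψ φ⟩` and `Re⟨φ, H_Φ φ⟩` about the untwisted torus).
Watanabe, J. Stat. Phys. 177 (2019) 717, §2.2.1 eqs. (13)–(16). [cite: Watanabe2019, §2.2.3 and §4.1] -/
theorem minEnergyOn_uniformTwistConfig_le_rayleigh_twist (U : ℝ) (N : ℕ) (M : ℝ) (Φ Ψ : ℝ)
    (φ : Fock (Orb (FermionTorus 2 L))) (hφ : φ ∈ szSector N M) (h1 : star φ ⬝ᵥ φ = 1) :
    (magneticHubbardTorus L (uniformTwistConfig L Ψ) 1 U).minEnergyOn (szSector N M) ≤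
      (star φ ⬝ᵥ (magneticHubbardTorus L (uniformTwistConfig L Φ) 1 U *ᵥ φ)).re +
        2 * (Real.cos (Φ / L) - Real.cos (Ψ / L)) *
          (∑ x : Site 2 L, ∑ σ : Fin 2,
            (star φ ⬝ᵥ ((creation (orb (FermionTorus.ofTorusSite (Site.shift x 0)) σ) *
              annihilation (orb (FermionTorus.ofTorusSite x) σ)) *ᵥ φ)).re) +
        2 * (Real.sin (Ψ / L) - Real.sin (Φ / L)) *
          (∑ x : Site 2 L, ∑ σ : Fin 2,
            (star φ ⬝ᵥ ((creation (orb (FermionTorus.ofTorusSite (Site.shift x 0)) σ) *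
              annihilation (orb (FermionTorus.ofTorusSite x) σ)) *ᵥ φ)).im) := by
  have h := minEnergyOn_le_rayleigh_of_mem (magneticHubbardTorus_isHermitian _ 1 U) _ hφ h1
    (H := magneticHubbardTorus L (uniformTwistConfig L Ψ) 1 U)
  rw [re_star_dotProduct_magneticHubbardTorus_uniformTwistConfig_mulVec] at h
  rw [re_star_dotProduct_magneticHubbardTorus_uniformTwistConfig_mulVec]
  linarith

/-- The trigonometric bookkeeping of the two-twist pricing: with `P = 2(K cos a - J sin a)` and
`Q = 2(K sin a + J cos a)`,
`2(cos a - cos(a + s)) K + 2(sin(a + s) - sin a) J = P (1 - cos s) + Q sin s`. [folklore] -/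
theorem two_twist_trig (a s K J : ℝ) :
    2 * (Real.cos a - Real.cos (a + s)) * K + 2 * (Real.sin (a + s) - Real.sin a) * J =
      2 * (K * Real.cos a - J * Real.sin a) * (1 - Real.cos s) +
        2 * (K * Real.sin a + J * Real.cos a) * Real.sin s := by
  rw [Real.cos_add, Real.sin_add]; ring

/-- **Two-twist pricing of the flux envelope** (`L ≥ 3`): for every unit vector `φ` of the sector
`(N_L, 0)` and all real `Φ, s`,
`E_L(Φ + sL) ≤ Re⟨φ, H_Φ φ⟩ + P(φ)(1 - cos s) + Q(φ) sin s`, `P = 2(K cos(Φ/L) - J̃ sin(Φ/L))`,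
`Q = 2(K sin(Φ/L) + J̃ cos(Φ/L))`. Watanabe (2019) §2.2.1, §2.2.3. [cite: Watanabe2019, §2.2.3 and §4.1] -/
theorem fluxEnergy_le_rayleigh_add_pricing (hL : 3 ≤ L) (U δ Φ s : ℝ)
    (φ : Fock (Orb (FermionTorus 2 L))) (hφ : φ ∈ szSector (2 * ⌊(1 - δ) * (L : ℝ) ^ 2 / 2⌋₊) 0)
    (h1 : star φ ⬝ᵥ φ = 1) :
    fluxEnergy L U δ (Φ + s * L) ≤
      (star φ ⬝ᵥ (magneticHubbardTorus L (uniformTwistConfig L Φ) 1 U *ᵥ φ)).re +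
        2 * ((∑ x : Site 2 L, ∑ σ : Fin 2,
            (star φ ⬝ᵥ ((creation (orb (FermionTorus.ofTorusSite (Site.shift x 0)) σ) *
              annihilation (orb (FermionTorus.ofTorusSite x) σ)) *ᵥ φ)).re) * Real.cos (Φ / L) -
          (∑ x : Site 2 L, ∑ σ : Fin 2,
            (star φ ⬝ᵥ ((creation (orb (FermionTorus.ofTorusSite (Site.shift x 0)) σ) *
              annihilation (orb (FermionTorus.ofTorusSite x) σ)) *ᵥ φ)).im) * Real.sin (Φ / L)) *
          (1 - Real.cos s) +
        2 * ((∑ x : Site 2 L, ∑ σ : Fin 2,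
            (star φ ⬝ᵥ ((creation (orb (FermionTorus.ofTorusSite (Site.shift x 0)) σ) *
              annihilation (orb (FermionTorus.ofTorusSite x) σ)) *ᵥ φ)).re) * Real.sin (Φ / L) +
          (∑ x : Site 2 L, ∑ σ : Fin 2,
            (star φ ⬝ᵥ ((creation (orb (FermionTorus.ofTorusSite (Site.shift x 0)) σ) *
              annihilation (orb (FermionTorus.ofTorusSite x) σ)) *ᵥ φ)).im) * Real.cos (Φ / L)) *
          Real.sin s := by
  have hLpos : (0 : ℝ) < L := Nat.cast_pos.2 (by omega)
  have h := minEnergyOn_uniformTwistConfig_le_rayleigh_twist U _ 0 Φ (Φ + s * L) φ hφ h1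
  rw [← fluxEnergy_eq_minEnergyOn_uniformTwistConfig hL] at h
  have hdiv : (Φ + s * L) / L = Φ / L + s := by field_simp
  rw [hdiv] at h
  set K := ∑ x : Site 2 L, ∑ σ : Fin 2,
      (star φ ⬝ᵥ ((creation (orb (FermionTorus.ofTorusSite (Site.shift x 0)) σ) *
        annihilation (orb (FermionTorus.ofTorusSite x) σ)) *ᵥ φ)).re with hK
  set J := ∑ x : Site 2 L, ∑ σ : Fin 2,
      (star φ ⬝ᵥ ((creation (orb (FermionTorus.ofTorusSite (Site.shift x 0)) σ) *
        annihilation (orb (FermionTorus.ofTorusSite x) σ)) *ᵥ φ)).im with hJ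
  have ht := two_twist_trig (Φ / L) s K J
  linarith

/-! ### Bloch's theorem at every flux -/

/-- **Bloch's theorem at flux `Φ`** (`L ≥ 4`, `0 ≤ δ`): if a unit vector `φ` of the sector `(N_L, 0)`
attains the flux envelope in the uniformly twisted torus, `Re⟨φ, H_Φ φ⟩ = E_L(Φ)`, then its
gauge-covariant `e₁`-current `Q = 2(K sin(Φ/L) + J̃ cos(Φ/L))` is bounded by its gauge-covariant
kinetic weight `P = 2(K cos(Φ/L) - J̃ sin(Φ/L))`: `|Q| ≤ (π²/(2L)) |P|`. Proof: adding `±2π` of flux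
is a pure gauge at any base flux (`E_L(Φ ± 2π) = E_L(Φ)`), so pricing `φ` at `Φ ± 2π` gives
`0 ≤ P(1 - cos(2π/L)) ± Q sin(2π/L)`; then `1 - cos e ≤ e²/2` and Jordan's `sin e ≥ (2/π) e` on
`[0, π/2]` (`e = 2π/L ≤ π/2`). Bohm (1949); Watanabe (2019) §2.2.1; Tada–Koma (2016) §2.
[cite: Bohm1949, Bloch's theorem] -/
theorem abs_current_le_of_rayleigh_eq_fluxEnergy (hL : 4 ≤ L) (U δ Φ : ℝ)
    (φ : Fock (Orb (FermionTorus 2 L))) (hφ : φ ∈ szSector (2 * ⌊(1 - δ) * (L : ℝ) ^ 2 / 2⌋₊) 0)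
    (h1 : star φ ⬝ᵥ φ = 1)
    (hE : (star φ ⬝ᵥ (magneticHubbardTorus L (uniformTwistConfig L Φ) 1 U *ᵥ φ)).re =
      fluxEnergy L U δ Φ) :
    |2 * ((∑ x : Site 2 L, ∑ σ : Fin 2,
            (star φ ⬝ᵥ ((creation (orb (FermionTorus.ofTorusSite (Site.shift x 0)) σ) *
              annihilation (orb (FermionTorus.ofTorusSite x) σ)) *ᵥ φ)).re) * Real.sin (Φ / L) +
          (∑ x : Site 2 L, ∑ σ : Fin 2,
            (star φ ⬝ᵥ ((creation (orb (FermionTorus.ofTorusSite (Site.shift x 0)) σ) *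
              annihilation (orb (FermionTorus.ofTorusSite x) σ)) *ᵥ φ)).im) * Real.cos (Φ / L))| ≤
      Real.pi ^ 2 / (2 * L) *
        |2 * ((∑ x : Site 2 L, ∑ σ : Fin 2,
            (star φ ⬝ᵥ ((creation (orb (FermionTorus.ofTorusSite (Site.shift x 0)) σ) *
              annihilation (orb (FermionTorus.ofTorusSite x) σ)) *ᵥ φ)).re) * Real.cos (Φ / L) -
          (∑ x : Site 2 L, ∑ σ : Fin 2,
            (star φ ⬝ᵥ ((creation (orb (FermionTorus.ofTorusSite (Site.shift x 0)) σ) *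
              annihilation (orb (FermionTorus.ofTorusSite x) σ)) *ᵥ φ)).im) * Real.sin (Φ / L))| := by
  have hL3 : 3 ≤ L := by omega
  have hLpos : (0 : ℝ) < L := Nat.cast_pos.2 (by omega)
  have hL4 : (4 : ℝ) ≤ L := by exact_mod_cast hL
  have hπ := Real.pi_pos
  -- `±2π` of flux is a pure gauge: price `φ` at `Φ ± 2π` (`s = ±e`, `e = 2π/L`)
  have hper := fluxEnergy_periodic L U δ
  have hp := fluxEnergy_le_rayleigh_add_pricing hL3 U δ Φ (2 * Real.pi / L) φ hφ h1
  have hm := fluxEnergy_le_rayleigh_add_pricing hL3 U δ Φ (-(2 * Real.pi / L)) φ hφ h1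
  have hargp : Φ + 2 * Real.pi / L * L = Φ + 2 * Real.pi := by field_simp
  have hargm : Φ + -(2 * Real.pi / L) * L = Φ - 2 * Real.pi := by field_simp; ring
  rw [hargp, hper Φ, ← hE] at hp
  rw [hargm, hper.sub_eq Φ, ← hE, Real.cos_neg, Real.sin_neg] at hm
  -- abbreviations (introduced after the pricing facts, so that they are folded everywhere)
  set K := ∑ x : Site 2 L, ∑ σ : Fin 2,
      (star φ ⬝ᵥ ((creation (orb (FermionTorus.ofTorusSite (Site.shift x 0)) σ) *
        annihilation (orb (FermionTorus.ofTorusSite x) σ)) *ᵥ φ)).re with hK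
  set J := ∑ x : Site 2 L, ∑ σ : Fin 2,
      (star φ ⬝ᵥ ((creation (orb (FermionTorus.ofTorusSite (Site.shift x 0)) σ) *
        annihilation (orb (FermionTorus.ofTorusSite x) σ)) *ᵥ φ)).im with hJ
  set P := 2 * (K * Real.cos (Φ / L) - J * Real.sin (Φ / L)) with hP
  set Q := 2 * (K * Real.sin (Φ / L) + J * Real.cos (Φ / L)) with hQ
  set e := 2 * Real.pi / L with he
  have hplus : 0 ≤ P * (1 - Real.cos e) + Q * Real.sin e := by linarith
  have hminus : 0 ≤ P * (1 - Real.cos e) - Q * Real.sin e := by linarith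
  -- elementary bounds on `e = 2π/L ∈ (0, π/2]`
  have hepos : 0 < e := by rw [he]; positivity
  have he0 : 0 ≤ e := hepos.le
  have he2 : e ≤ Real.pi / 2 := by
    rw [he, div_le_div_iff₀ hLpos two_pos]
    nlinarith
  have hsin : 2 / Real.pi * e ≤ Real.sin e := Real.mul_le_sin he0 he2
  have hcos : 1 - Real.cos e ≤ e ^ 2 / 2 := by
    have := Real.one_sub_sq_div_two_le_cos (x := e); linarith
  have hcos0 : 0 ≤ 1 - Real.cos e := by linarith [Real.cos_le_one e]
  -- `|Q| sin e ≤ P (1 - cos e) ≤ |P| e²/2`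
  have hQP : |Q| * Real.sin e ≤ |P| * (e ^ 2 / 2) := by
    have h1' : |Q| * Real.sin e ≤ P * (1 - Real.cos e) := by
      rcases le_or_gt 0 Q with hq | hq
      · rw [abs_of_nonneg hq]; linarith
      · rw [abs_of_neg hq]; linarith
    have h2' : P * (1 - Real.cos e) ≤ |P| * (1 - Real.cos e) :=
      mul_le_mul_of_nonneg_right (le_abs_self P) hcos0
    have h3' : |P| * (1 - Real.cos e) ≤ |P| * (e ^ 2 / 2) :=
      mul_le_mul_of_nonneg_left hcos (abs_nonneg P)
    linarith
  -- divide by Jordan's bound: `|Q| (2/π) e ≤ |P| e²/2`, i.e. `|Q| ≤ |P| π e / 4 = |P| π²/(2L)`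
  have hQe : |Q| * (2 / Real.pi * e) ≤ |P| * (e ^ 2 / 2) :=
    (mul_le_mul_of_nonneg_left hsin (abs_nonneg Q)).trans hQP
  have h' : |Q| * (2 / Real.pi) ≤ |P| * (e / 2) := by
    have h3 : |Q| * (2 / Real.pi * e) = (|Q| * (2 / Real.pi)) * e := by ring
    have h4 : |P| * (e ^ 2 / 2) = (|P| * (e / 2)) * e := by ring
    rw [h3, h4] at hQe
    exact le_of_mul_le_mul_right hQe hepos
  have h5 : |Q| * (2 / Real.pi) * (Real.pi / 2) = |Q| := by field_simp
  have h'' : |Q| ≤ |P| * (e / 2) * (Real.pi / 2) := by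
    have := mul_le_mul_of_nonneg_right h' (le_of_lt (half_pos hπ))
    linarith
  have heq : |P| * (e / 2) * (Real.pi / 2) = Real.pi ^ 2 / (2 * L) * |P| := by
    rw [he]; field_simp
  linarith

/-! ### The modulus of continuity -/

/-- The real-variable bookkeeping of the modulus of continuity: if `|K|, |J| ≤ 2L²` and the current
`Q = 2(K sin a + J cos a)` obeys Bloch's bound `|Q| ≤ (π²/(2L)) |P|`, `P = 2(K cos a - J sin a)`, then
the pricing excess at `s = η/L` is at most `4π²|η| + 4η²`:
`P(1 - cos(η/L)) + Q sin(η/L) ≤ 4π²|η| + 4η²` (`1 - cos s ≤ s²/2`, `|sin s| ≤ |s|`). [folklore] -/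
theorem pricing_excess_le {Lr K J a η : ℝ} (hL : 0 < Lr) (hK : |K| ≤ 2 * Lr ^ 2)
    (hJ : |J| ≤ 2 * Lr ^ 2)
    (hQ : |2 * (K * Real.sin a + J * Real.cos a)| ≤
      Real.pi ^ 2 / (2 * Lr) * |2 * (K * Real.cos a - J * Real.sin a)|) :
    2 * (K * Real.cos a - J * Real.sin a) * (1 - Real.cos (η / Lr)) +
        2 * (K * Real.sin a + J * Real.cos a) * Real.sin (η / Lr) ≤
      4 * Real.pi ^ 2 * |η| + 4 * η ^ 2 := by
  set P := 2 * (K * Real.cos a - J * Real.sin a) with hPdef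
  set Q := 2 * (K * Real.sin a + J * Real.cos a) with hQdef
  have hPb : |P| ≤ 8 * Lr ^ 2 := by
    have hc := Real.abs_cos_le_one a
    have hs := Real.abs_sin_le_one a
    have h1 : |K * Real.cos a| ≤ |K| := by
      rw [abs_mul]; exact mul_le_of_le_one_right (abs_nonneg K) hc
    have h2 : |J * Real.sin a| ≤ |J| := by
      rw [abs_mul]; exact mul_le_of_le_one_right (abs_nonneg J) hs
    have h3 : |K * Real.cos a - J * Real.sin a| ≤ |K * Real.cos a| + |J * Real.sin a| :=
      abs_sub _ _
    have h4 : |P| = 2 * |K * Real.cos a - J * Real.sin a| := by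
      rw [hPdef, abs_mul, abs_two]
    linarith
  have hQb : |Q| ≤ 4 * Real.pi ^ 2 * Lr := by
    calc |Q| ≤ Real.pi ^ 2 / (2 * Lr) * |P| := hQ
      _ ≤ Real.pi ^ 2 / (2 * Lr) * (8 * Lr ^ 2) := mul_le_mul_of_nonneg_left hPb (by positivity)
      _ = 4 * Real.pi ^ 2 * Lr := by field_simp; ring
  -- elementary trigonometric bounds at `s = η / Lr`
  have hcos : 1 - Real.cos (η / Lr) ≤ (η / Lr) ^ 2 / 2 := by
    have := Real.one_sub_sq_div_two_le_cos (x := η / Lr); linarith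
  have hcos0 : 0 ≤ 1 - Real.cos (η / Lr) := by linarith [Real.cos_le_one (η / Lr)]
  have hsin : |Real.sin (η / Lr)| ≤ |η / Lr| := Real.abs_sin_le_abs
  have hterm1 : P * (1 - Real.cos (η / Lr)) ≤ 4 * η ^ 2 := by
    calc P * (1 - Real.cos (η / Lr)) ≤ |P| * (1 - Real.cos (η / Lr)) :=
            mul_le_mul_of_nonneg_right (le_abs_self P) hcos0
      _ ≤ (8 * Lr ^ 2) * ((η / Lr) ^ 2 / 2) := mul_le_mul hPb hcos hcos0 (by positivity)
      _ = 4 * η ^ 2 := by field_simp; ring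
  have hterm2 : Q * Real.sin (η / Lr) ≤ 4 * Real.pi ^ 2 * |η| := by
    calc Q * Real.sin (η / Lr) ≤ |Q * Real.sin (η / Lr)| := le_abs_self _
      _ = |Q| * |Real.sin (η / Lr)| := abs_mul _ _
      _ ≤ (4 * Real.pi ^ 2 * Lr) * |η / Lr| := mul_le_mul hQb hsin (abs_nonneg _) (by positivity)
      _ = 4 * Real.pi ^ 2 * |η| := by rw [abs_div, abs_of_pos hL]; field_simp
  linarith

/-- **The flux envelope is uniformly Lipschitz** (`L ≥ 4`, `0 ≤ δ`): for all real `Φ, η`,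
`E_L(Φ + η) ≤ E_L(Φ) + 4π²|η| + 4η²`, uniformly in `L`, `U`, `δ`. Proof: price a unit vector
attaining `E_L(Φ)` at the flux `Φ + η` (`s = η/L`): the excess is `P(1 - cos s) + Q sin s ≤
|P| s²/2 + |Q| |s|` with `|P| ≤ 2(|K| + |J̃|) ≤ 8L²` and, by Bloch's theorem at flux `Φ`,
`|Q| ≤ (π²/(2L))|P| ≤ 4π² L`. Bohm (1949); Watanabe (2019) §2.2.1, §4.1 (the derivative of the
envelope is the persistent current, `O(1)` uniformly in `L`). [folklore] -/
theorem fluxEnergy_add_le (hL : 4 ≤ L) (U : ℝ) {δ : ℝ} (hδ : 0 ≤ δ) (Φ η : ℝ) :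
    fluxEnergy L U δ (Φ + η) ≤ fluxEnergy L U δ Φ + 4 * Real.pi ^ 2 * |η| + 4 * η ^ 2 := by
  have hL3 : 3 ≤ L := by omega
  have hLpos : (0 : ℝ) < L := Nat.cast_pos.2 (by omega)
  obtain ⟨φ, hφ, h1, hE⟩ := exists_unit_rayleigh_eq_fluxEnergy hL3 U hδ Φ
  -- pricing at `Φ + η` (`s = η / L`), Bloch at flux `Φ`, the hopping bounds, and bookkeeping
  have hprice := fluxEnergy_le_rayleigh_add_pricing hL3 U δ Φ (η / L) φ hφ h1
  have harg : Φ + η / L * L = Φ + η := by field_simp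
  rw [harg, hE] at hprice
  have hexcess := pricing_excess_le (η := η) hLpos (abs_sum_re_hop_le h1) (abs_sum_im_hop_le h1)
    (abs_current_le_of_rayleigh_eq_fluxEnergy hL U δ Φ φ hφ h1 hE)
  linarith

/-- **Two-sided form**: `|E_L(Φ) - E_L(Φ')| ≤ 4π²|Φ - Φ'| + 4(Φ - Φ')²` for all real `Φ, Φ'`
(`L ≥ 4`, `0 ≤ δ`), uniformly in `L`, `U`, `δ`. [folklore] -/
theorem abs_fluxEnergy_sub_fluxEnergy_le (hL : 4 ≤ L) (U : ℝ) {δ : ℝ} (hδ : 0 ≤ δ) (Φ Φ' : ℝ) :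
    |fluxEnergy L U δ Φ - fluxEnergy L U δ Φ'| ≤ 4 * Real.pi ^ 2 * |Φ - Φ'| + 4 * (Φ - Φ') ^ 2 := by
  have h1 := fluxEnergy_add_le hL U hδ Φ' (Φ - Φ')
  have h2 := fluxEnergy_add_le hL U hδ Φ (Φ' - Φ)
  rw [add_sub_cancel] at h1 h2
  rw [abs_sub_comm Φ' Φ, show (Φ' - Φ) ^ 2 = (Φ - Φ') ^ 2 by ring] at h2
  rw [abs_le]
  constructor <;> linarith

/-- **Local Lipschitz form**: for `|Φ - Φ'| ≤ 1`, `|E_L(Φ) - E_L(Φ')| ≤ (4π² + 4)|Φ - Φ'|`. [folklore] -/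
theorem abs_fluxEnergy_sub_fluxEnergy_le_mul (hL : 4 ≤ L) (U : ℝ) {δ : ℝ} (hδ : 0 ≤ δ) {Φ Φ' : ℝ}
    (h : |Φ - Φ'| ≤ 1) :
    |fluxEnergy L U δ Φ - fluxEnergy L U δ Φ'| ≤ (4 * Real.pi ^ 2 + 4) * |Φ - Φ'| := by
  have h0 := abs_fluxEnergy_sub_fluxEnergy_le hL U hδ Φ Φ'
  have hsq : (Φ - Φ') ^ 2 ≤ |Φ - Φ'| := by
    rw [← sq_abs]
    nlinarith [abs_nonneg (Φ - Φ')]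
  linarith

/-- **The flux envelope is continuous in the flux** (`L ≥ 4`, `0 ≤ δ`). [folklore] -/
theorem continuous_fluxEnergy (hL : 4 ≤ L) (U : ℝ) {δ : ℝ} (hδ : 0 ≤ δ) :
    Continuous (fluxEnergy L U δ) := by
  refine Metric.continuous_iff.2 fun Φ ε hε => ?_
  refine ⟨min 1 (ε / (4 * Real.pi ^ 2 + 5)), lt_min one_pos (by positivity), fun Φ' hΦ' => ?_⟩
  rw [Real.dist_eq] at hΦ' ⊢
  have hlt1 : |Φ' - Φ| < 1 := lt_of_lt_of_le hΦ' (min_le_left _ _)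
  have hlt2 : |Φ' - Φ| < ε / (4 * Real.pi ^ 2 + 5) := lt_of_lt_of_le hΦ' (min_le_right _ _)
  have h := abs_fluxEnergy_sub_fluxEnergy_le_mul hL U hδ hlt1.le
  have hpos : (0 : ℝ) < 4 * Real.pi ^ 2 + 5 := by positivity
  calc |fluxEnergy L U δ Φ' - fluxEnergy L U δ Φ| ≤ (4 * Real.pi ^ 2 + 4) * |Φ' - Φ| := h
    _ ≤ (4 * Real.pi ^ 2 + 4) * (ε / (4 * Real.pi ^ 2 + 5)) :=
        mul_le_mul_of_nonneg_left hlt2.le (by positivity)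
    _ < ε := by
        rw [mul_div_assoc']
        rw [div_lt_iff₀ hpos]
        nlinarith

/-- **Uniform equicontinuity of the flux envelopes** (`0 ≤ δ`): for every `ε > 0` there is
`η₀ > 0` such that `|E_L(Φ) - E_L(Φ')| < ε` whenever `|Φ - Φ'| < η₀`, for ALL `L ≥ 4`, `U` and
flux values — the input of every compactness (Arzelà–Ascoli) argument on sequences of flux
envelopes. [folklore] -/
theorem fluxEnergy_uniformEquicontinuous {δ : ℝ} (hδ : 0 ≤ δ) {ε : ℝ} (hε : 0 < ε) :
    ∃ η₀ : ℝ, 0 < η₀ ∧ ∀ (L : ℕ) [NeZero L], 4 ≤ L → ∀ (U Φ Φ' : ℝ), |Φ - Φ'| < η₀ →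
      |fluxEnergy L U δ Φ - fluxEnergy L U δ Φ'| < ε := by
  refine ⟨min 1 (ε / (4 * Real.pi ^ 2 + 5)), lt_min one_pos (by positivity), ?_⟩
  intro L _ hL U Φ Φ' hΦ
  have hlt1 : |Φ - Φ'| < 1 := lt_of_lt_of_le hΦ (min_le_left _ _)
  have hlt2 : |Φ - Φ'| < ε / (4 * Real.pi ^ 2 + 5) := lt_of_lt_of_le hΦ (min_le_right _ _)
  have h := abs_fluxEnergy_sub_fluxEnergy_le_mul hL U hδ hlt1.le
  have hpos : (0 : ℝ) < 4 * Real.pi ^ 2 + 5 := by positivity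
  calc |fluxEnergy L U δ Φ - fluxEnergy L U δ Φ'| ≤ (4 * Real.pi ^ 2 + 4) * |Φ - Φ'| := h
    _ ≤ (4 * Real.pi ^ 2 + 4) * (ε / (4 * Real.pi ^ 2 + 5)) :=
        mul_le_mul_of_nonneg_left hlt2.le (by positivity)
    _ < ε := by
        rw [mul_div_assoc']
        rw [div_lt_iff₀ hpos]
        nlinarith

end Literature.MathematicalPhysics.QuantumLattice
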